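import Summits.AtomisticToContinuum.FouriersLaw.Theorems.BondHeatUncertaintySubdiffusiveBondHeatSiteEnergyDynkinTruncation
import Summits.AtomisticToContinuum.FouriersLaw.Theorems.PhononMeanFreePathBoundaryKuboEnergyBalance

/-!
# Corrector identity for the two-mode profile, part 1a: truncation error for the left block energies
(helper, `--supports` crux stmt-AtomisticToContinuum-12111 `PuiseuxTransferLedger.TwoModeBulk`, line `Sketch`)

The explicit profile of the crux, `u_N(i) = (γ/T²)∫₀^∞ Cov_{μ₀}(p_0², K_t p_i²) dt - 1/2`, is rewritten on the
finite-volume Green–Kubo corrector through the BOND-RESOLVED CORRECTOR IDENTITIES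
`γ ∫₀^∞ Cov_{μ₀}(p_0², K_t p_i²) dt = T²·[i ≤ m] + ∫₀^∞ Cov_{μ₀}(j_m, K_t p_i²) dt` (every bond `m`), whose
dynamical input is the Doob–Dynkin identity for the WEIGHT `E_{≤m}` (BLR's left block energy,
`HardTether.leftEnergy`; `L E_{≤m} = γ(T - p_0²) - j_m`, `IncoherentBounded.pinnedChain_generator_leftEnergy`) along the
reversed kernels (part 1b), obtained from the `C²_c` case by energy truncation. This part is the truncation estimate:

* `pinnedChain_abs_generator_truncLeftEnergy_sub_le` — `|L(E_{≤m} χ(H/R)) - χ(H/R) L E_{≤m}| ≤ (A/R)(1+H)²` for all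
  `R ≥ 1` (`χ = smoothCutoff`; `generator_mul_smoothCutoff_hamiltonian`; same proof as
  `pinnedChain_abs_generator_truncSplitSite_sub_le` of `…FeshbachIdentitiesSiteEnergyDynkin`, with `0 ≤ E_{≤m} ≤ H` and
  `∂_{p_b} E_{≤m} = [b ≤ m] p_b`).
No definitions; nothing here closes the item.
-/


noncomputable section

open scoped NNReal ENNReal Topology
open MeasureTheory Filter Set

namespace Summit.AtomisticToContinuum.FouriersLaw.Theorems.TwoModeBulk.Sketch

open Literature.MathematicalPhysics.KineticTheory.HeatConduction
open Literature.MathematicalPhysics.KineticTheory Literature.Probability.Process OscillatorChain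
open ProbabilityTheory
open Literature.MathematicalPhysics.KineticTheory.HeatConduction.HardTether
  (leftEnergy blockWeight bondWeight bondCurrent_add_generator_leftEnergy partialP_leftEnergy)
open Summit.AtomisticToContinuum.FouriersLaw.Theorems.SubdiffusiveBondHeat
open Summit.AtomisticToContinuum.FouriersLaw.Theorems.BoundaryKubo.GibbsTtcf
open Summit.AtomisticToContinuum.FouriersLaw.Theorems.LinearResponseFTUR (sq_momentum_le)

variable {N : ℕ}

/-! ### The truncation error -/

/-- **The truncation error for a left block energy.** For the `(N+1)`-site pinned chain (`ω₂ > 0`, `lam, β, γ ≥ 0`),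
a genuine bond `m < N` and `T ≥ 0` there is `A ≥ 0` with
`|L(E_{≤m} χ(H/R)) - χ(H/R) L E_{≤m}| ≤ (A/R)(1 + H)²` for all `R ≥ 1` (`χ = smoothCutoff`): the difference is
`E_{≤m} Lχ_R + Γ(E_{≤m}, χ_R)` (`generator_mul_smoothCutoff_hamiltonian`) with `∂_{p_b} E_{≤m} = [b ≤ m] p_b`,
`χ', χ''` bounded, `0 ≤ E_{≤m} ≤ H`, `p_b² ≤ 2H`. [folklore] -/
theorem pinnedChain_abs_generator_truncLeftEnergy_sub_le {ω₂ lam β γ : ℝ} (hω : 0 < ω₂) (hl : 0 ≤ lam)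
    (hβ : 0 ≤ β) (hγ : 0 ≤ γ) (m : Fin (N + 1)) {T : ℝ} (hT : 0 ≤ T) :
    ∃ A : ℝ, 0 ≤ A ∧ ∀ R : ℝ, 1 ≤ R → ∀ z : PhaseSpace (N + 1),
      |(pinnedChain ω₂ lam β γ).generator (N + 1) T T (fun y => leftEnergy (pinnedChain ω₂ lam β γ) (N + 1) m y *
            smoothCutoff ((pinnedChain ω₂ lam β γ).hamiltonian (N + 1) y / R)) z -
          smoothCutoff ((pinnedChain ω₂ lam β γ).hamiltonian (N + 1) z / R) *
            (pinnedChain ω₂ lam β γ).generator (N + 1) T T (leftEnergy (pinnedChain ω₂ lam β γ) (N + 1) m) z| ≤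
        A / R * (1 + (pinnedChain ω₂ lam β γ).hamiltonian (N + 1) z) ^ 2 := by
  have hN0 : 0 < N + 1 := Nat.succ_pos N
  have hN1 : N + 1 - 1 < N + 1 := Nat.sub_lt hN0 one_pos
  obtain ⟨M₁, hM₁0, hM₁⟩ := exists_bound_deriv_smoothCutoff
  obtain ⟨M₂, hM₂0, hM₂⟩ := exists_bound_deriv_deriv_smoothCutoff
  refine ⟨γ * (10 * M₁ * T + 4 * M₁ + 4 * M₂ * T), by positivity, fun R hR z => ?_⟩
  have hR0 : 0 < R := lt_of_lt_of_le one_pos hR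
  set P := pinnedChain ω₂ lam β γ with hP
  have hconf : P.IsConfining := pinnedChain_isConfining hω hl hβ hγ
  have hTγ : 0 ≤ P.γ * T := mul_nonneg hγ hT
  have hU2 : ContDiff ℝ 2 P.U := pinnedChain_contDiff_U ω₂ lam β γ
  have hV2 : ContDiff ℝ 2 P.V := pinnedChain_contDiff_V ω₂ lam β γ
  have hE2 : ContDiff ℝ 2 (leftEnergy P (N + 1) m) := contDiff_leftEnergy P hU2 hV2 (N + 1) m
  have hγ' : P.γ = γ := rfl
  rw [generator_mul_smoothCutoff_hamiltonian hU2 hV2 hN0 hTγ hTγ hE2 R z, partialP_leftEnergy P m,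
    partialP_leftEnergy P m, hγ', add_sub_cancel_left]
  beta_reduce
  -- the elementary bounds
  have hU0 := hconf.U_nonneg
  have hV0 := hconf.V_nonneg
  have hE0 : 0 ≤ leftEnergy P (N + 1) m z := leftEnergy_nonneg P hU0 hV0 (N + 1) m z
  have hEH : leftEnergy P (N + 1) m z ≤ P.hamiltonian (N + 1) z := leftEnergy_le_hamiltonian P hU0 hV0 (N + 1) m z
  have hH0 : 0 ≤ P.hamiltonian (N + 1) z := hconf.hamiltonian_nonneg (N + 1) z
  have ha : z.2 ⟨0, hN0⟩ ^ 2 ≤ 2 * P.hamiltonian (N + 1) z := sq_momentum_le hU0 hV0 z _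
  have hb : z.2 ⟨N + 1 - 1, hN1⟩ ^ 2 ≤ 2 * P.hamiltonian (N + 1) z := sq_momentum_le hU0 hV0 z _
  have hχ₁b := hM₁ (P.hamiltonian (N + 1) z / R)
  have hχ₂b := hM₂ (P.hamiltonian (N + 1) z / R)
  have hδ : ∀ (k : Fin (N + 1)), |z.2 k * (blockWeight m k * z.2 k)| ≤ z.2 k ^ 2 := by
    intro k
    have hw := blockWeight_nonneg_le_one m k
    rw [show z.2 k * (blockWeight m k * z.2 k) = blockWeight m k * z.2 k ^ 2 by ring, abs_mul,
      abs_of_nonneg hw.1, abs_of_nonneg (sq_nonneg _)]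
    exact (mul_le_of_le_one_left (sq_nonneg _) hw.2)
  have hd0 := hδ ⟨0, hN0⟩
  have hd1 := hδ ⟨N + 1 - 1, hN1⟩
  -- make the atoms opaque
  generalize (blockWeight m ⟨0, hN0⟩ * z.2 ⟨0, hN0⟩) = d0 at hd0 ⊢
  generalize (blockWeight m ⟨N + 1 - 1, hN1⟩ * z.2 ⟨N + 1 - 1, hN1⟩) = d1 at hd1 ⊢
  generalize deriv smoothCutoff (P.hamiltonian (N + 1) z / R) = χ₁ at hχ₁b ⊢
  generalize deriv (deriv smoothCutoff) (P.hamiltonian (N + 1) z / R) = χ₂ at hχ₂b ⊢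
  generalize leftEnergy P (N + 1) m z = E at hE0 hEH ⊢
  generalize P.hamiltonian (N + 1) z = Hx at hH0 ha hb hEH ⊢
  generalize z.2 ⟨0, hN0⟩ = p at ha hd0 ⊢
  generalize z.2 ⟨N + 1 - 1, hN1⟩ = q at hb hd1 ⊢
  have ha0 : 0 ≤ p ^ 2 := sq_nonneg _
  have hb0 : 0 ≤ q ^ 2 := sq_nonneg _
  have habH : p ^ 2 + q ^ 2 ≤ 4 * Hx := by linarith
  -- everything carries a factor `γ/R`
  have key : E * (γ * (χ₁ / R * (T + T - p ^ 2 - q ^ 2) + χ₂ / R ^ 2 * (T * p ^ 2 + T * q ^ 2))) +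
      χ₁ / R * (2 * γ * T * p * d0 + 2 * γ * T * q * d1) =
      γ / R * (E * (χ₁ * (2 * T - p ^ 2 - q ^ 2) + χ₂ * T * (p ^ 2 + q ^ 2) / R) + χ₁ * (2 * T * (p * d0 + q * d1))) := by
    field_simp
    ring
  have hin : |E * (χ₁ * (2 * T - p ^ 2 - q ^ 2) + χ₂ * T * (p ^ 2 + q ^ 2) / R) + χ₁ * (2 * T * (p * d0 + q * d1))| ≤
      E * (M₁ * (2 * T + p ^ 2 + q ^ 2) + M₂ * T * (p ^ 2 + q ^ 2)) + M₁ * (2 * T * (p ^ 2 + q ^ 2)) := by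
    have h1 : |χ₁ * (2 * T - p ^ 2 - q ^ 2)| ≤ M₁ * (2 * T + p ^ 2 + q ^ 2) := by
      rw [abs_mul]
      refine mul_le_mul hχ₁b ?_ (abs_nonneg _) hM₁0
      rw [abs_le]; constructor <;> linarith
    have h2 : |χ₂ * T * (p ^ 2 + q ^ 2) / R| ≤ M₂ * T * (p ^ 2 + q ^ 2) := by
      rw [abs_div, abs_mul, abs_mul, abs_of_nonneg hT, abs_of_nonneg (add_nonneg ha0 hb0), abs_of_pos hR0]
      calc |χ₂| * T * (p ^ 2 + q ^ 2) / R ≤ |χ₂| * T * (p ^ 2 + q ^ 2) / 1 :=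
            div_le_div_of_nonneg_left (by positivity) one_pos hR
        _ ≤ M₂ * T * (p ^ 2 + q ^ 2) := by
            rw [div_one]
            exact mul_le_mul_of_nonneg_right (mul_le_mul_of_nonneg_right hχ₂b hT) (add_nonneg ha0 hb0)
    have h3 : |χ₁ * (2 * T * (p * d0 + q * d1))| ≤ M₁ * (2 * T * (p ^ 2 + q ^ 2)) := by
      rw [abs_mul]
      refine mul_le_mul hχ₁b ?_ (abs_nonneg _) hM₁0
      rw [abs_mul, abs_of_nonneg (by positivity : (0:ℝ) ≤ 2 * T)]
      refine mul_le_mul_of_nonneg_left ((abs_add_le _ _).trans (add_le_add hd0 hd1)) (by positivity)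
    calc |E * (χ₁ * (2 * T - p ^ 2 - q ^ 2) + χ₂ * T * (p ^ 2 + q ^ 2) / R) + χ₁ * (2 * T * (p * d0 + q * d1))|
        ≤ |E * (χ₁ * (2 * T - p ^ 2 - q ^ 2) + χ₂ * T * (p ^ 2 + q ^ 2) / R)| + |χ₁ * (2 * T * (p * d0 + q * d1))| :=
          abs_add_le _ _
      _ = E * |χ₁ * (2 * T - p ^ 2 - q ^ 2) + χ₂ * T * (p ^ 2 + q ^ 2) / R| + |χ₁ * (2 * T * (p * d0 + q * d1))| := by
          rw [abs_mul, abs_of_nonneg hE0]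
      _ ≤ E * (|χ₁ * (2 * T - p ^ 2 - q ^ 2)| + |χ₂ * T * (p ^ 2 + q ^ 2) / R|) + |χ₁ * (2 * T * (p * d0 + q * d1))| := by
          gcongr
          exact abs_add_le _ _
      _ ≤ E * (M₁ * (2 * T + p ^ 2 + q ^ 2) + M₂ * T * (p ^ 2 + q ^ 2)) + M₁ * (2 * T * (p ^ 2 + q ^ 2)) := by
          gcongr
  have hpoly : E * (M₁ * (2 * T + p ^ 2 + q ^ 2) + M₂ * T * (p ^ 2 + q ^ 2)) + M₁ * (2 * T * (p ^ 2 + q ^ 2)) ≤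
      (10 * M₁ * T + 4 * M₁ + 4 * M₂ * T) * (1 + Hx) ^ 2 := by
    have hM₁T : 0 ≤ M₁ * T := mul_nonneg hM₁0 hT
    have hM₂T : 0 ≤ M₂ * T := mul_nonneg hM₂0 hT
    have hS : 2 * T + p ^ 2 + q ^ 2 ≤ 2 * T + 4 * Hx := by linarith
    have s1 : E * (M₁ * (2 * T + p ^ 2 + q ^ 2) + M₂ * T * (p ^ 2 + q ^ 2)) ≤
        Hx * (M₁ * (2 * T + 4 * Hx) + M₂ * T * (4 * Hx)) :=
      mul_le_mul hEH (add_le_add (mul_le_mul_of_nonneg_left hS hM₁0) (mul_le_mul_of_nonneg_left habH hM₂T))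
        (by positivity) hH0
    have s2 : M₁ * (2 * T * (p ^ 2 + q ^ 2)) ≤ M₁ * (2 * T * (4 * Hx)) :=
      mul_le_mul_of_nonneg_left (mul_le_mul_of_nonneg_left habH (by positivity)) hM₁0
    have s4 : Hx * (M₁ * (2 * T + 4 * Hx) + M₂ * T * (4 * Hx)) + M₁ * (2 * T * (4 * Hx)) ≤
        (10 * M₁ * T + 4 * M₁ + 4 * M₂ * T) * (1 + Hx) ^ 2 := by
      have hex : (10 * M₁ * T + 4 * M₁ + 4 * M₂ * T) * (1 + Hx) ^ 2 -
          (Hx * (M₁ * (2 * T + 4 * Hx) + M₂ * T * (4 * Hx)) + M₁ * (2 * T * (4 * Hx))) =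
          10 * (M₁ * T) + 10 * (M₁ * T * Hx) + 10 * (M₁ * T * Hx * Hx) + 4 * M₁ + 8 * (M₁ * Hx) +
            4 * (M₂ * T) + 8 * (M₂ * T * Hx) := by
        ring
      have h1 := mul_nonneg hM₁T hH0
      have h2 := mul_nonneg h1 hH0
      have h3 := mul_nonneg hM₁0 hH0
      have h4 := mul_nonneg hM₂T hH0
      linarith
    linarith
  rw [key, abs_mul, abs_div, abs_of_nonneg hγ, abs_of_pos hR0]
  calc γ / R * |E * (χ₁ * (2 * T - p ^ 2 - q ^ 2) + χ₂ * T * (p ^ 2 + q ^ 2) / R) + χ₁ * (2 * T * (p * d0 + q * d1))|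
      ≤ γ / R * (E * (M₁ * (2 * T + p ^ 2 + q ^ 2) + M₂ * T * (p ^ 2 + q ^ 2)) + M₁ * (2 * T * (p ^ 2 + q ^ 2))) :=
        mul_le_mul_of_nonneg_left hin (div_nonneg hγ hR0.le)
    _ ≤ γ / R * ((10 * M₁ * T + 4 * M₁ + 4 * M₂ * T) * (1 + Hx) ^ 2) :=
        mul_le_mul_of_nonneg_left hpoly (div_nonneg hγ hR0.le)
    _ = γ * (10 * M₁ * T + 4 * M₁ + 4 * M₂ * T) / R * (1 + Hx) ^ 2 := by ring

/-- **Registered sub-goal `twoModeBulk_truncLeftEnergy`** of crux stmt-AtomisticToContinuum-12111 (line `Sketch`, corrector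
identity (★), part 1a): `pinnedChain_abs_generator_truncLeftEnergy_sub_le` as a closed statement (`ω₂ > 0`,
`lam, β, γ ≥ 0`, `N + 1` sites, block `m`, `T ≥ 0`). [folklore] -/
theorem twoModeBulk_truncLeftEnergy :
    ∀ ω₂ lam β γ : ℝ, 0 < ω₂ → 0 ≤ lam → 0 ≤ β → 0 ≤ γ → ∀ (N : ℕ) (m : Fin (N + 1)) (T : ℝ), 0 ≤ T → ∃ A : ℝ, 0 ≤ A ∧ ∀ R : ℝ, 1 ≤ R → ∀ z : Literature.MathematicalPhysics.KineticTheory.HeatConduction.PhaseSpace (N + 1), |(Literature.MathematicalPhysics.KineticTheory.HeatConduction.pinnedChain ω₂ lam β γ).generator (N + 1) T T (fun y => Literature.MathematicalPhysics.KineticTheory.HeatConduction.HardTether.leftEnergy (Literature.MathematicalPhysics.KineticTheory.HeatConduction.pinnedChain ω₂ lam β γ) (N + 1) m y * Literature.MathematicalPhysics.KineticTheory.HeatConduction.smoothCutoff ((Literature.MathematicalPhysics.KineticTheory.HeatConduction.pinnedChain ω₂ lam β γ).hamiltonian (N + 1) y / R)) z - Literature.MathematicalPhysics.KineticTheory.HeatConduction.smoothCutoff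 ((Literature.MathematicalPhysics.KineticTheory.HeatConduction.pinnedChain ω₂ lam β γ).hamiltonian (N + 1) z / R) * (Literature.MathematicalPhysics.KineticTheory.HeatConduction.pinnedChain ω₂ lam β γ).generator (N + 1) T T (Literature.MathematicalPhysics.KineticTheory.HeatConduction.HardTether.leftEnergy (Literature.MathematicalPhysics.KineticTheory.HeatConduction.pinnedChain ω₂ lam β γ) (N + 1) m) z| ≤ A / R * (1 + (Literature.MathematicalPhysics.KineticTheory.HeatConduction.pinnedChain ω₂ lam β γ).hamiltonian (N + 1) z) ^ 2 :=
  fun _ _ _ _ hω hl hβ hγ _ m _ hT => pinnedChain_abs_generator_truncLeftEnergy_sub_le hω hl hβ hγ m hT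

end Summit.AtomisticToContinuum.FouriersLaw.Theorems.TwoModeBulk.Sketch

end
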